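import Summits.QuantumFields.YangMills.Theorems.BalabanUVNodesN26AtRecord11
import Literature.MathematicalPhysics.QuantumFieldTheory.Balaban1983to89.Node00.Record11Beta

/-!
# DAG node N26 — B4 «β-continuity»: THE (D4)-CHAIN INSTANCE AT THE β OF RECORD BY NAME, `Node00.betaOfRecord₁₁ θ` ∕ `oneLoopSplitOfRecord₁₁ θ`
# (def-B's `Node00/Record11Beta.lean`, p451949) — `Gaps.BetaContFromD4Chain.betaContH_of_chainTFac190H` θ-KEYED AND PROVISO-FREE, in CHAIN and
# RESIDUE currency; what an inhabitant SAYS of the record's merged β; the inhabitant BUILT from the (D4) socket; «N26 closes WITH N25» in the two named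
# predicates `Gaps.D1Residue.Residue` ∧ `Gaps.BetaContFromD4Chain.AtSlopeCont` AT THE RECORD'S OWN SPLIT

Cell `pub-ymgap`, YM-PLAN Track A (HUMAN RULING D-0062), seat `pub-ymgap-dag-n26-c` gen 2 (R134 acceleration re-seat, strategy s2 = BY-NAME KNIT at the ₁₁
record; director-ym row «the (D4)-chain INSTANCE `Gaps.BetaContFromD4Chain.betaContH_of_chainTFac190H` for the datum of record at `betaOfRecord₁₁` (crew D4 files
by name)»).  Sibling of gen 0's `BalabanUVNodesN26AtRecord11` (p449759; SOCKET currency at `(datumOfRecord₁₁ θ hP).βfun`, 398 l.), written the hour seat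
node00-def-B minted the NAME LAYER at Stage 11 (`betaOfRecord₁₁`, `betaMergedOfRecord₁₁`, `beta0OfRecord₁₁`, `oneLoopSplitOfRecord₁₁`; trigger (t1) of gen 0's
HANDOFF).  STATUS OF RECORD: N26 = binder B4 is DEPENDENT on (D4) and VACATED in the discharge form of record (closes WITH B3 = N25, NODE O); the (D4)-chain
instance for Bałaban's objects is 0∕1 (crew `b2b-balaban-beta-an4` row (D4); objects-side half `B13Core214EntryHolomorphic` p435418, `B13TermWalksPullback` p445942).

WHY A SIBLING AND WHAT IS NEW.  The β of record at Stage 11 is now a NAME defined for EVERY `θ : Stage11Params` — no provisos `hP`, no datum — so the crew's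
(D4) chain `Beta.RemainderDecay190HoloChain.ChainTFac190H` (fields `A1` = the localized leaf kernels `A¹_{k+1}(p; Y, ·)` of [I] (1.7), `beta1_eq` = «β¹ IS the
second moment (1.22) of the leaf-sum kernel `Σ'_Y A1`», `leaves` = the [II]-(2.38) ∕ (190) ∕ (4.4) ∕ (1.7) torus leaf records `Beta.RemainderLocalityHolo.PolLeavesTFac190H`)
can be TYPED AT THE RECORD'S OWN SPLIT `oneLoopSplitOfRecord₁₁ θ : OneLoopSplit (betaOfRecord₁₁ θ)` — the split is never a choice (`oneLoopSplit_unique`, §0) —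
and the fold `betaContH_of_chainTFac190H` read there is a statement about θ alone.  CHAIN currency is WEAKER than gen 0's socket list: it asks the split
identity at SECOND-MOMENT level (`beta1_eq`), not the kernel-level localized representation `hrep` + the one-loop kernel `P0` with (5.10); §2 says what it
asks in the record's letters, §3 builds it from the socket.
* §0 keys: N26's literal at the datum IS the literal at the name (`Iff.rfl`); every split of `betaOfRecord₁₁ θ` IS `oneLoopSplitOfRecord₁₁ θ`, so its one-loop
  field IS `beta0OfRecord₁₁ θ` and its (D4)∧B4 residue `AtSlopeCont` IS the record split's.
* §1 THE FOLD AT THE NAME: `betaContH_betaOfRecord₁₁_of_chainTFac190H` (holomorphic currency), `…_of_chainTFac190` (analytic currency, `ChainTFac190H.ofAnalytic`),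
  `…_of_atSlopeCont` (residue currency); the merged reading `continuousOn_betaMergedOfRecord₁₁_of_chainTFac190H` (def-B's `betaContH_betaOfRecord₁₁_iff`);
  N26's literal `n26lit_betaOfRecord₁₁_of_chainTFac190H`; at the datum `n26_datumOfRecord₁₁_of_atSlopeCont`.
* §2 WHAT AN INHABITANT SAYS AT ₁₁: `betaMergedOfRecord₁₁_eq_of_chainTFac190H` — on `]0,γ₀]^{k+1}`, `γ₀ ≤ θ.γ`: `β_merged,k+1(p) = β⁰_{k+1} + Σ_z (Σ'_Y A1 k p Y z) z_μ z_ν`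
  ([I] (2.12)–(2.13) + (1.7) at second-moment level, the chain's `beta1_eq` unmasked); `cpt_iff_continuousOn_polLimit_of_rep` — under the kernel-level localized
  representation `hrep` the clause (C-pt) `CPt R` IS history-continuity of the merged LIMIT kernel (1.21) of the record's family on the box (gen 0's `hcont`).
* §3 THE INSTANCE BUILT FROM THE (D4) SOCKET AT THE NAMES: `exists_chainTFac190H_oneLoopSplitOfRecord₁₁` (`∃ R, R.A1 = A1 ∧ CPt R` from `P0 ∕ hβ0 ∕ hP0 ∕ A1 ∕ hrep ∕
  hleaves ∕ side conditions ∕ hcont`; `beta1_eq` by (1.22)-additivity under (5.10), dag-n26-a's `secondMoment_eq_add_of_decay510`), and the residue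
  `atSlopeCont_oneLoopSplitOfRecord₁₁_of_localizedRep` (dag-n26-a's `atSlopeCont_betaOfMerged` BY NAME).
* §4 RECORD LEVEL in residue currency: `n26_of_isRecordOfRecord₁₁C_of_atSlopeCont`, the route ∀-form `n26_B4lit_rec11C_of_atSlopeCont`.
* §5 «N26 CLOSES WITH N25» IN TWO NAMED PREDICATES AT THE RECORD'S SPLIT: `endpoint_and_n26_datumOfRecord₁₁_of_residue_atSlopeCont` (row (D1)'s residue
  `Gaps.D1Residue.Residue Lc Js Nc μ ν` with its pin ON `beta0OfRecord₁₁ θ` + `AtSlopeCont (oneLoopSplitOfRecord₁₁ θ) γ₀ (stepBal Nc Lc)` ⟹ END ∧ B4;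
  `Gaps.BetaContFromD4Chain.endpointExistence_of_residue_atSlopeCont` at def-B's `forwardGenerated_datumOfRecord₁₁`), its record-predicate form, and
  `s_N25_and_n26_B4lit_rec11C_of_residue_atSlopeCont` — the β-side shape route crux K2 `EndpointGivenBR11` quantifies over, in residue currency.

HONEST FRAMING.  Count-neutral bookkeeping by name for a VACATED binder; 0 `def`, 0 `sorry`, no estimate.  Every chain ∕ residue ∕ socket input below (`R :
ChainTFac190H …`, `CPt R`, `AtSlopeCont …`, `P0 ∕ hβ0 ∕ hP0 ∕ A1 ∕ hrep ∕ hleaves ∕ hcont`, the side conditions, the (D1) residue and pin) is a located HYPOTHESIS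
of NODE O ∕ rows (D1), (D4) about the record's OWN merged term family `mergedTermFamilyMatT F N (TcOfRecord F N) (chiFixed7 F N θ.ν) θ.εbg` — INSTANCE 0∕1;
the zero-activity witness (`RemainderWitness.zeroChain190` ∕ `splitZero`) inhabits the chain only for the flat split of `β ≡ 0` — the WRONG β — and is NOT
used anywhere below.  `IsRecordOfRecord₁₁C` is not junk-inhabited (K0 `Record11Inhabited` is analytic), so the ∀-forms are NOT-A-DISCHARGE (INHABITED-AT-₁₁C
guard); N25 ∕ N26 NOT discharged; nothing of Bałaban's β asserted.  One finite four-torus programme at fixed ε per run — NOT the continuum limit, NOT ℝ⁴, NOT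
infinite volume, NOT OS, NOT a mass gap, NOT Clay.
Sources (context): [I] = [Balaban1987RG1] CMP **109** (1987): Thm 2 p. 259, (0.13) p. 254, (1.6)–(1.7) p. 261, (1.20)–(1.22) p. 264, (2.12)–(2.14) p. 268,
(4.4) p. 281, (5.10) p. 293; [II] = [Balaban1988RG2Cluster] CMP **116** (1988): Lemma 3 (2.38) p. 20; [Balaban1985Variational] CMP **102** (1985): (190)
p. 308; [Balaban1989LargeFieldII] CMP **122** (1989): Thm 1 p. 355.
-/

noncomputable section

open scoped Matrix.Norms.L2Operator

namespace Summit.QuantumFields.YangMills.Theorems.BalabanUVNodesN26AtBetaOfRecord11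

open Literature.MathematicalPhysics.QuantumFieldTheory.Balaban1983to89
open Literature.MathematicalPhysics.QuantumFieldTheory.Balaban1983to89.FlowStep
open Literature.MathematicalPhysics.QuantumFieldTheory.Balaban1983to89.DagBinding (EndpointExistence WorldP)
open Literature.MathematicalPhysics.QuantumFieldTheory.Balaban1983to89.T4Continuum (T4Family FiniteEpsData)
open Literature.MathematicalPhysics.QuantumFieldTheory.Balaban1983to89.Node00
open Literature.MathematicalPhysics.QuantumFieldTheory.Balaban1983to89.B13ScaleTransfer (Pt)
open Literature.MathematicalPhysics.QuantumFieldTheory.Balaban1983to89.Beta.RemainderChain (remActivity)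
open Literature.MathematicalPhysics.QuantumFieldTheory.Balaban1983to89.Beta.RemainderChainLattice
open Literature.MathematicalPhysics.QuantumFieldTheory.Balaban1983to89.Beta.RemainderLimitTorus (LDom limKernel)
open Literature.MathematicalPhysics.QuantumFieldTheory.Balaban1983to89.Beta.RemainderLimitTorusHolo
open Literature.MathematicalPhysics.QuantumFieldTheory.Balaban1983to89.Beta.RemainderDecay190
open Literature.MathematicalPhysics.QuantumFieldTheory.Balaban1983to89.Beta.RemainderLocalityHolo (PolLeavesTFac190H)
open Literature.MathematicalPhysics.QuantumFieldTheory.Balaban1983to89.Beta.RemainderDecay190HoloChain (ChainTFac190H)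
open Literature.MathematicalPhysics.QuantumFieldTheory.Balaban1983to89.Beta.OneStepKernelFamily (TbalOf)
open Literature.MathematicalPhysics.QuantumFieldTheory.Balaban1983to89.Beta.OneStepResolventKernel (JetData)
open Summit.QuantumFields.BalabanUV.Gaps
open Summit.QuantumFields.BalabanUV.Gaps.BetaContFromD4Chain
open Summit.QuantumFields.YangMills.Theorems.BalabanUVNodesN26Merged (atSlopeCont_betaOfMerged secondMoment_eq_add_of_decay510)
open Summit.QuantumFields.YangMills.BalabanUVNodes.N28AtBetaOfRecord (oneLoopSplit_unique)
open Filter Topology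

variable (F : T4Family) (N : ℕ) [NeZero N]

/-! ## §0 Keys: the literal at the datum IS the literal at the name; the split of `betaOfRecord₁₁ θ` is never a choice -/

section Keys

/-- **N26's LITERAL AT THE STAGE-11 DATUM IS THE LITERAL AT THE β OF RECORD BY NAME** (`(datumOfRecord₁₁ θ h).βfun = betaOfRecord₁₁ θ` is `rfl`, def-B's
`βfun_datumOfRecord₁₁_eq_betaOfRecord₁₁`; the right-hand side mentions no provisos). [cite: Balaban1987RG1, (1.20)-(1.22) p.264 (bookkeeping)] -/
theorem n26lit_datumOfRecord₁₁_iff_betaOfRecord₁₁ (θ : Stage11Params F N) (h : θ.Provisos₁₁) :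
    (∃ γc : ℝ, 0 < γc ∧ BetaContH γc (datumOfRecord₁₁ F N θ h).βfun) ↔ ∃ γc : ℝ, 0 < γc ∧ BetaContH γc (betaOfRecord₁₁ F N θ) :=
  Iff.rfl

/-- **EVERY ONE-LOOP SPLIT OF THE β OF RECORD IS def-B's `oneLoopSplitOfRecord₁₁ θ`** (dag-n28-a's `oneLoopSplit_unique` BY NAME: `β⁰_k = β_k(0,…,0)` by `vanish`,
then `β¹ = β − β⁰`) — so the split parameter `S` of a (D4) chain `ChainTFac190H 4 M μ ν S γ₀ c ℓ α₂ q` at `betaOfRecord₁₁ θ` is never a choice.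
[cite: Balaban1987RG1, (2.12)-(2.14) p.268] -/
theorem oneLoopSplit_eq_oneLoopSplitOfRecord₁₁ (θ : Stage11Params F N) (Sβ : B12Beta.OneLoopSplit (betaOfRecord₁₁ F N θ)) :
    Sβ = oneLoopSplitOfRecord₁₁ F N θ :=
  oneLoopSplit_unique _ _

/-- … hence every split's one-loop field IS the one-loop number of record `beta0OfRecord₁₁ θ` — the object every NODE-O pin `hβ : Sβ.β0 j = Σ_z T̄_j(z) z_μ z_ν` ((D1)'s
identification), positivity (AF-0) or tail hypothesis speaks about. [cite: Balaban1987RG1, (2.12)-(2.14) p.268] -/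
theorem β0_eq_beta0OfRecord₁₁ (θ : Stage11Params F N) (Sβ : B12Beta.OneLoopSplit (betaOfRecord₁₁ F N θ)) :
    Sβ.β0 = beta0OfRecord₁₁ F N θ := by
  have h := oneLoopSplit_eq_oneLoopSplitOfRecord₁₁ F N θ Sβ
  subst h
  rfl

/-- … and the rows-(D4) ∧ B4 residue `AtSlopeCont Sβ γ₀ s` at ANY split of the β of record IS the residue at the record's split.
[cite: Balaban1988RG2Cluster, Lemma 3 (2.38) p.20; Balaban1987RG1, (1.20)-(1.22) p.264] -/
theorem atSlopeCont_iff_oneLoopSplitOfRecord₁₁ (θ : Stage11Params F N) (Sβ : B12Beta.OneLoopSplit (betaOfRecord₁₁ F N θ)) (γ₀ s : ℝ) :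
    AtSlopeCont Sβ γ₀ s ↔ AtSlopeCont (oneLoopSplitOfRecord₁₁ F N θ) γ₀ s := by
  rw [oneLoopSplit_eq_oneLoopSplitOfRecord₁₁ F N θ Sβ]

end Keys

/-! ## §1 The (D4)-chain fold at the name `betaOfRecord₁₁ θ` — θ-keyed, proviso-free — in chain and residue currency -/

section Fold

variable {M : ℕ} [NeZero M] {μ ν : Fin 4} {γ₀ : ℝ} {c : B13.Consts} {ℓ α₂ : ℝ} {q : Consts190}

/-- **THE (D4)-CHAIN INSTANCE AT THE β OF RECORD BY NAME ⟹ B4 ON ITS BOX** (director-ym R134 row, holomorphic currency): ONE inhabitant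
`R : ChainTFac190H 4 M μ ν (oneLoopSplitOfRecord₁₁ F N θ) γ₀ c ℓ α₂ q` of the crew's row-(D4) chain AT THE RECORD'S OWN SPLIT (leaf kernels `R.A1 k p` = the
localized `A¹_{k+1}(p; Y, ·)` of (1.7) whose leaf-sum second moments ARE `β_merged − β⁰` on the box, with [II]-(2.38) ∕ (190) ∕ (4.4) torus leaf records), the
side conditions and the ONE clause (C-pt) `CPt R` ⟹ `BetaContH γ₀ (betaOfRecord₁₁ F N θ)` — for EVERY `θ : Stage11Params` (no provisos, no datum);
`Gaps.BetaContFromD4Chain.betaContH_of_chainTFac190H` BY NAME.  THIS inhabitant is what NODE O ∕ row (D4) owe for Bałaban's construction: instance 0∕1.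
[cite: Balaban1987RG1, (1.7) p.261, (1.20)-(1.22) p.264 and (5.10) p.293; Balaban1988RG2Cluster, Lemma 3 (2.38) p.20] -/
theorem betaContH_betaOfRecord₁₁_of_chainTFac190H (θ : Stage11Params F N) (R : ChainTFac190H 4 M μ ν (oneLoopSplitOfRecord₁₁ F N θ) γ₀ c ℓ α₂ q)
    (hC : CondsL 4 c ℓ) (h22 : c.R22gen ℓ) (hq : q.Valid c.δ₀) (hs : SignsL c α₂ q.B₃) (hcont : CPt R) :
    BetaContH γ₀ (betaOfRecord₁₁ F N θ) :=
  betaContH_of_chainTFac190H R hC h22 hq hs (by norm_num) hcont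

/-- **The same in ANALYTIC currency** (the crew's `Beta.RemainderDecay190.ChainTFac190` socket — analyticity leaves `AnalyticOnNhd ℂ` ∕ `AnalyticAt ℂ` — IS a
holomorphic-currency chain, `ChainTFac190H.ofAnalytic`; `Gaps.BetaContFromD4Chain.betaContH_of_chainTFac190`). [cite: Balaban1987RG1, (1.7) p.261, (1.22) p.264, (4.4) p.281 and (5.10) p.293] -/
theorem betaContH_betaOfRecord₁₁_of_chainTFac190 (θ : Stage11Params F N) (R : ChainTFac190 4 M μ ν (oneLoopSplitOfRecord₁₁ F N θ) γ₀ c ℓ α₂ q)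
    (hC : CondsL 4 c ℓ) (h22 : c.R22gen ℓ) (hq : q.Valid c.δ₀) (hs : SignsL c α₂ q.B₃) (hcont : CPt (ChainTFac190H.ofAnalytic R)) :
    BetaContH γ₀ (betaOfRecord₁₁ F N θ) :=
  betaContH_of_chainTFac190 R hC h22 hq hs (by norm_num) hcont

/-- **The same in RESIDUE currency**: the rows-(D4) ∧ B4 residue `AtSlopeCont (oneLoopSplitOfRecord₁₁ F N θ) γ₀ s` (SOME cube side, channel, [II]-record,
transfer factor, (4.4)-radius, (190)-record and chain with (C-pt), slope `s`) ⟹ B4 on the box (`betaContH_of_atSlopeCont`; the slope is idle for B4).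
[cite: Balaban1988RG2Cluster, Lemma 3 (2.38) p.20; Balaban1987RG1, (1.22) p.264 and (5.10) p.293] -/
theorem betaContH_betaOfRecord₁₁_of_atSlopeCont (θ : Stage11Params F N) {s : ℝ} (h : AtSlopeCont (oneLoopSplitOfRecord₁₁ F N θ) γ₀ s) :
    BetaContH γ₀ (betaOfRecord₁₁ F N θ) :=
  betaContH_of_atSlopeCont h

/-- **WHAT THE INSTANCE BUYS IN THE RECORD'S LETTERS**: on a box inside the box of record (`γ₀ ≤ θ.γ`) the chain + (C-pt) give per-`k` history-continuity of the
MERGED β of record `betaMergedOfRecord₁₁ θ k` — (1.22) of the merged term (1.6) over `(TcOfRecord, chiFixed7 θ.ν)` — on `]0,γ₀]^{k+1}` (def-B's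
`betaContH_betaOfRecord₁₁_iff` BY NAME). [cite: Balaban1987RG1, (1.6) p.261 and (1.20)-(1.22) p.264] -/
theorem continuousOn_betaMergedOfRecord₁₁_of_chainTFac190H (θ : Stage11Params F N) (hle : γ₀ ≤ θ.γ)
    (R : ChainTFac190H 4 M μ ν (oneLoopSplitOfRecord₁₁ F N θ) γ₀ c ℓ α₂ q) (hC : CondsL 4 c ℓ) (h22 : c.R22gen ℓ) (hq : q.Valid c.δ₀)
    (hs : SignsL c α₂ q.B₃) (hcont : CPt R) (k : ℕ) : ContinuousOn (betaMergedOfRecord₁₁ F N θ k) (Box γ₀ k) :=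
  (betaContH_betaOfRecord₁₁_iff θ hle).mp (betaContH_betaOfRecord₁₁_of_chainTFac190H F N θ R hC h22 hq hs hcont) k

/-- **N26's LITERAL AT THE β OF RECORD BY NAME** from the instance + side conditions + (C-pt) on a box `0 < γ₀` (`γc := γ₀`).
[cite: Balaban1987RG1, (1.7) p.261, (1.20)-(1.22) p.264 and (5.10) p.293; Balaban1988RG2Cluster, Lemma 3 (2.38) p.20] -/
theorem n26lit_betaOfRecord₁₁_of_chainTFac190H (θ : Stage11Params F N) (hγ₀ : 0 < γ₀)
    (R : ChainTFac190H 4 M μ ν (oneLoopSplitOfRecord₁₁ F N θ) γ₀ c ℓ α₂ q) (hC : CondsL 4 c ℓ) (h22 : c.R22gen ℓ) (hq : q.Valid c.δ₀)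
    (hs : SignsL c α₂ q.B₃) (hcont : CPt R) : ∃ γc : ℝ, 0 < γc ∧ BetaContH γc (betaOfRecord₁₁ F N θ) :=
  ⟨γ₀, hγ₀, betaContH_betaOfRecord₁₁_of_chainTFac190H F N θ R hC h22 hq hs hcont⟩

/-- **N26 AT THE STAGE-11 DATUM from the residue at the record's split** on a box `0 < γ₀` (any slope). [cite: Balaban1987RG1, (1.20)-(1.22) p.264; Balaban1988RG2Cluster, Lemma 3 (2.38) p.20] -/
theorem n26_datumOfRecord₁₁_of_atSlopeCont (θ : Stage11Params F N) (hP : θ.Provisos₁₁) (hγ₀ : 0 < γ₀) {s : ℝ}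
    (h : AtSlopeCont (oneLoopSplitOfRecord₁₁ F N θ) γ₀ s) : ∃ γc : ℝ, 0 < γc ∧ BetaContH γc (datumOfRecord₁₁ F N θ hP).βfun :=
  ⟨γ₀, hγ₀, betaContH_of_atSlopeCont h⟩

end Fold

/-! ## §2 What an inhabitant of the chain at the record's split SAYS of the record's objects -/

section Unmask

variable {M : ℕ} [NeZero M] {μ ν : Fin 4} {γ₀ : ℝ} {c : B13.Consts} {ℓ α₂ : ℝ} {q : Consts190}

/-- **THE CHAIN'S `beta1_eq` UNMASKED AT THE RECORD**: an inhabitant `R` of the (D4) chain at `oneLoopSplitOfRecord₁₁ θ` on a box `γ₀ ≤ θ.γ` SAYS that for every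
history `p ∈ ]0,γ₀]^{k+1}` the MERGED β of record (the second moment (1.22) of the limit kernel (1.21) of the merged term family) IS the one-loop number of
record plus the second moment of the leaf-sum kernel `Σ'_Y R.A1 k p Y ·` in the chain's channel `(μ, ν)` — [I] (2.12)–(2.13) (merged term = `log Z^{(k)}` +
`E^{(k+1)}`) with the localized representation (1.7) of the remainder, AT SECOND-MOMENT LEVEL (weaker than the kernel-level `hrep` of the socket form).
This is the located identity NODE O owes for Bałaban's kernels; nothing is asserted. [cite: Balaban1987RG1, (1.7) p.261, (1.20)-(1.22) p.264 and (2.12)-(2.13) p.268] -/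
theorem betaMergedOfRecord₁₁_eq_of_chainTFac190H (θ : Stage11Params F N) (R : ChainTFac190H 4 M μ ν (oneLoopSplitOfRecord₁₁ F N θ) γ₀ c ℓ α₂ q)
    (hle : γ₀ ≤ θ.γ) {k : ℕ} {p : Fin (k + 1) → ℝ} (hp : p ∈ Box γ₀ k) :
    betaMergedOfRecord₁₁ F N θ k p = beta0OfRecord₁₁ F N θ k + B12Beta.secondMoment (fun _ _ => limKernel (R.A1 k p)) μ ν := by
  have hp' : p ∈ B12Beta.HistBox γ₀ k := by rw [histBox_eq_box]; exact hp
  have h := R.beta1_eq k p hp'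
  have h' : (oneLoopSplitOfRecord₁₁ F N θ).β1 k p = betaMergedOfRecord₁₁ F N θ k p - beta0OfRecord₁₁ F N θ k := by
    show (Box θ.γ k).indicator (fun w => betaMergedOfRecord₁₁ F N θ k w - beta0OfRecord₁₁ F N θ k) p = _
    exact Set.indicator_of_mem (box_mono hle k hp) _
  rw [h'] at h
  linarith

/-- **(C-pt) ON THE CHAIN IS (C-pt) ON THE MERGED LIMIT KERNEL OF RECORD, under the kernel-level localized representation**: if the chain's leaf kernels split the
merged LIMIT kernel (1.21) of THE record's family as `polLimit … ℰ₁₁ k p … 0 1 z = P0 k z + Σ'_Y R.A1 k p Y z` on the box with a history-free one-loop kernel `P0 k`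
(gen 0's socket input `hrep`), then `CPt R` (termwise history-continuity of `p ↦ Σ'_Y R.A1 k p Y z`) ↔ history-continuity of `p ↦ polLimit … z` on the box
(gen 0's input `hcont`; [I] p. 264 after (1.22)) — the two differ by the constant `P0 k z`. [cite: Balaban1987RG1, (1.21)-(1.22) p.264 and (2.12)-(2.13) p.268] -/
theorem cpt_iff_continuousOn_polLimit_of_rep (θ : Stage11Params F N) (R : ChainTFac190H 4 M μ ν (oneLoopSplitOfRecord₁₁ F N θ) γ₀ c ℓ α₂ q)
    (P0 : ℕ → Pt 4 → ℝ)
    (hrep : letI := θ.instVβ₁; letI := θ.instVβ₂; letI := θ.instιβ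
      ∀ k (p : Fin (k + 1) → ℝ), p ∈ Box γ₀ k → ∀ z : Pt 4,
        polLimit F (k + 1) (fun K => mergedTermFamilyMatT F N (TcOfRecord F N) (chiFixed7 F N θ.ν) θ.εbg k p K) θ.ρ8 θ.bV 0 1 z =
          P0 k z + limKernel (R.A1 k p) z) :
    CPt R ↔
      letI := θ.instVβ₁; letI := θ.instVβ₂; letI := θ.instιβ
      ∀ k (z : Pt 4), ContinuousOn (fun p : Fin (k + 1) → ℝ =>
        polLimit F (k + 1) (fun K => mergedTermFamilyMatT F N (TcOfRecord F N) (chiFixed7 F N θ.ν) θ.εbg k p K) θ.ρ8 θ.bV 0 1 z) (Box γ₀ k) := by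
  letI := θ.instVβ₁; letI := θ.instVβ₂; letI := θ.instιβ
  refine ⟨fun h k z => ?_, fun h k z => ?_⟩
  · have h1 : ContinuousOn (fun p : Fin (k + 1) → ℝ => P0 k z + limKernel (R.A1 k p) z) (Box γ₀ k) :=
      continuousOn_const.add (h k z)
    exact h1.congr fun p hp => hrep k p hp z
  · have h1 : ContinuousOn (fun p : Fin (k + 1) → ℝ =>
        polLimit F (k + 1) (fun K => mergedTermFamilyMatT F N (TcOfRecord F N) (chiFixed7 F N θ.ν) θ.εbg k p K) θ.ρ8 θ.bV 0 1 z - P0 k z)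
        (Box γ₀ k) := (h k z).sub continuousOn_const
    exact h1.congr fun p hp => by
      show limKernel (R.A1 k p) z = _ - P0 k z
      rw [hrep k p hp z]; ring

end Unmask

/-! ## §3 The instance BUILT from the (D4) socket inputs at the Stage-11 names -/

section Build

variable {γ₀ : ℝ} {M : ℕ} [NeZero M] {c : B13.Consts} {ℓ α₂ : ℝ} {q : Consts190}

/-- **THE (D4)-CHAIN INSTANCE AT THE RECORD'S SPLIT, BUILT FROM THE SOCKET** (channel `(0, 1)`, box `γ₀ ≤ θ.γ`): from the history-free one-loop kernels `P0 k` with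
`hβ0 : beta0OfRecord₁₁ θ k = Σ_z P0 k z · z₀z₁` (the one-loop NUMBER of record IS the second moment of a coupling-free kernel) and their per-scale (5.10) decay `hP0`,
NODE O's leaf kernels `A1`, the kernel-level localized representation `hrep` of the merged LIMIT kernel of the record's family on the box, the [II]-(2.38) ∕ (190) ∕
(1.7) ∕ (4.4) leaves `hleaves`, the side conditions and history-continuity `hcont` of the merged limit kernel ⟹ THERE IS an inhabitant `R` of
`ChainTFac190H 4 M 0 1 (oneLoopSplitOfRecord₁₁ F N θ) γ₀ c ℓ α₂ q` WITH `R.A1 = A1` satisfying (C-pt) — `beta1_eq` by the definition of the split + `hrep` +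
additivity of (1.22) under absolute convergence (dag-n26-a's `secondMoment_eq_add_of_decay510`, the leaves' own (5.10) for the second summand), `CPt` = `hcont`
minus the constant `P0 k z`.  The construction dag-n26-a's `atSlopeCont_betaOfMerged` performs inside an `∃`, here with the inhabitant's leaf kernels EXPOSED.
For Bałaban's objects every input is located (NODE O): instance 0∕1. [cite: Balaban1987RG1, (1.7) p.261, (1.20)-(1.22) p.264, (2.12)-(2.13) p.268 and (5.10) p.293; Balaban1988RG2Cluster, Lemma 3 (2.38) p.20] -/
theorem exists_chainTFac190H_oneLoopSplitOfRecord₁₁ (θ : Stage11Params F N) (hle : γ₀ ≤ θ.γ) (P0 : ℕ → Pt 4 → ℝ)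
    (hβ0 : ∀ k, beta0OfRecord₁₁ F N θ k = B12Beta.secondMoment (fun _ _ => P0 k) 0 1)
    (hP0 : ∀ k, ∃ C δ₁ : ℝ, 0 < δ₁ ∧ B12Sec2to5.Decay510 (P0 k) C δ₁)
    (A1 : (k : ℕ) → (Fin (k + 1) → ℝ) → LDom 4 → Pt 4 → ℝ)
    (hrep : letI := θ.instVβ₁; letI := θ.instVβ₂; letI := θ.instιβ
      ∀ k (p : Fin (k + 1) → ℝ), p ∈ Box γ₀ k → ∀ z : Pt 4,
        polLimit F (k + 1) (fun K => mergedTermFamilyMatT F N (TcOfRecord F N) (chiFixed7 F N θ.ν) θ.εbg k p K) θ.ρ8 θ.bV 0 1 z =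
          P0 k z + limKernel (A1 k p) z)
    (hleaves : ∀ k (p : Fin (k + 1) → ℝ), p ∈ Box γ₀ k → PolLeavesTFac190H 4 M (A1 k p) c ℓ α₂ q)
    (hC : CondsL 4 c ℓ) (h22 : c.R22gen ℓ) (hq : q.Valid c.δ₀) (hs : SignsL c α₂ q.B₃)
    (hcont : letI := θ.instVβ₁; letI := θ.instVβ₂; letI := θ.instιβ
      ∀ k (z : Pt 4), ContinuousOn (fun p : Fin (k + 1) → ℝ =>
        polLimit F (k + 1) (fun K => mergedTermFamilyMatT F N (TcOfRecord F N) (chiFixed7 F N θ.ν) θ.εbg k p K) θ.ρ8 θ.bV 0 1 z) (Box γ₀ k)) :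
    ∃ R : ChainTFac190H 4 M 0 1 (oneLoopSplitOfRecord₁₁ F N θ) γ₀ c ℓ α₂ q, R.A1 = A1 ∧ CPt R := by
  letI := θ.instVβ₁; letI := θ.instVβ₂; letI := θ.instιβ
  refine ⟨{ A1 := A1, beta1_eq := fun k p hp => ?_, leaves := fun k p hp => hleaves k p ((histBox_eq_box γ₀ k) ▸ hp) }, rfl,
    fun k z => ?_⟩
  · have hp' : p ∈ Box γ₀ k := (histBox_eq_box γ₀ k) ▸ hp
    obtain ⟨C₀, δ₀, hδ₀, h0⟩ := hP0 k
    have h1 : B12Sec2to5.Decay510 (limKernel (A1 k p)) (remActivity c * polConstL 4 M c α₂ q.B₃) (deltaL 4 M c) :=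
      (((hleaves k p hp').toPolLeavesTFacH hq).toPolLeavesTLocH hs.α₂_pos).decay510 hC h22 hs (by norm_num)
    have hadd := secondMoment_eq_add_of_decay510 hδ₀ (deltaL_pos hC hs.δ₀_pos (by norm_num) (Nat.pos_of_neZero M)) h0 h1 (hrep k p hp')
    have hm : betaMergedOfRecord₁₁ F N θ k p =
        B12Beta.secondMoment (fun _ _ => P0 k) 0 1 + B12Beta.secondMoment (fun _ _ => limKernel (A1 k p)) 0 1 := hadd
    show (Box θ.γ k).indicator (fun w => betaMergedOfRecord₁₁ F N θ k w - beta0OfRecord₁₁ F N θ k) p = _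
    rw [Set.indicator_of_mem (box_mono hle k hp'), hβ0 k, hm]
    ring
  · have h : ContinuousOn (fun p : Fin (k + 1) → ℝ =>
        polLimit F (k + 1) (fun K => mergedTermFamilyMatT F N (TcOfRecord F N) (chiFixed7 F N θ.ν) θ.εbg k p K) θ.ρ8 θ.bV 0 1 z - P0 k z)
        (Box γ₀ k) := (hcont k z).sub continuousOn_const
    exact h.congr fun p hp => by
      show limKernel (A1 k p) z = _ - P0 k z
      rw [hrep k p hp z]; ring

/-- **THE ROWS-(D4) ∧ B4 RESIDUE AT THE RECORD'S SPLIT from the same socket inputs + smallness `ε₁·K_rem,L ≤ s`**: `AtSlopeCont (oneLoopSplitOfRecord₁₁ F N θ) γ₀ s`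
(dag-n26-a's `BalabanUVNodesN26Merged.atSlopeCont_betaOfMerged` BY NAME at the minted names). [cite: Balaban1987RG1, (1.7) p.261, (1.20)-(1.22) p.264 and (5.10) p.293; Balaban1988RG2Cluster, Lemma 3 (2.38) p.20] -/
theorem atSlopeCont_oneLoopSplitOfRecord₁₁_of_localizedRep (θ : Stage11Params F N) (hle : γ₀ ≤ θ.γ) {s : ℝ} (P0 : ℕ → Pt 4 → ℝ)
    (hβ0 : ∀ k, beta0OfRecord₁₁ F N θ k = B12Beta.secondMoment (fun _ _ => P0 k) 0 1)
    (hP0 : ∀ k, ∃ C δ₁ : ℝ, 0 < δ₁ ∧ B12Sec2to5.Decay510 (P0 k) C δ₁)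
    (A1 : (k : ℕ) → (Fin (k + 1) → ℝ) → LDom 4 → Pt 4 → ℝ)
    (hrep : letI := θ.instVβ₁; letI := θ.instVβ₂; letI := θ.instιβ
      ∀ k (p : Fin (k + 1) → ℝ), p ∈ Box γ₀ k → ∀ z : Pt 4,
        polLimit F (k + 1) (fun K => mergedTermFamilyMatT F N (TcOfRecord F N) (chiFixed7 F N θ.ν) θ.εbg k p K) θ.ρ8 θ.bV 0 1 z =
          P0 k z + limKernel (A1 k p) z)
    (hleaves : ∀ k (p : Fin (k + 1) → ℝ), p ∈ Box γ₀ k → PolLeavesTFac190H 4 M (A1 k p) c ℓ α₂ q)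
    (hC : CondsL 4 c ℓ) (h22 : c.R22gen ℓ) (hq : q.Valid c.δ₀) (hs : SignsL c α₂ q.B₃) (hsmall : c.ε₁ * remCoeffL 4 M c α₂ q.B₃ ≤ s)
    (hcont : letI := θ.instVβ₁; letI := θ.instVβ₂; letI := θ.instιβ
      ∀ k (z : Pt 4), ContinuousOn (fun p : Fin (k + 1) → ℝ =>
        polLimit F (k + 1) (fun K => mergedTermFamilyMatT F N (TcOfRecord F N) (chiFixed7 F N θ.ν) θ.εbg k p K) θ.ρ8 θ.bV 0 1 z) (Box γ₀ k)) :
    AtSlopeCont (oneLoopSplitOfRecord₁₁ F N θ) γ₀ s := by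
  letI := θ.instVβ₁; letI := θ.instVβ₂; letI := θ.instιβ
  exact atSlopeCont_betaOfMerged F _ θ.ρ8 θ.bV _ hle P0 hβ0 hP0 A1 hrep hleaves hC h22 hq hs hsmall hcont

end Build

/-! ## §4 Record level, residue currency: N26 at a Stage-11 record and the route supply's ∀-form -/

section Route

/-- **N26 AT A STAGE-11 RECORD `(D, w)` FROM THE RESIDUE AT THE RECORD'S SPLIT ON THE WORLD'S OWN WINDOW** (`Node00.IsRecordOfRecord₁₁C F N D w`): if every
admissible presentation `θ` (with provisos) of `D` with `w.γ ≤ θ.γ` carries, at SOME slope, the rows-(D4) ∧ B4 residue `AtSlopeCont (oneLoopSplitOfRecord₁₁ F N θ) w.γ s`,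
then `∃ γc > 0, BetaContH γc D.βfun` (`γc := w.γ`; `0 < w.γ` is a clause of the record predicate).  A located hypothesis of NODE O; instance 0∕1; N26 NOT discharged.
[cite: Balaban1987RG1, (1.20)-(1.22) p.264; Balaban1988RG2Cluster, Lemma 3 (2.38) p.20; Balaban1989LargeFieldII, Thm 1 p.355 (the record)] -/
theorem n26_of_isRecordOfRecord₁₁C_of_atSlopeCont {D : FiniteEpsData F (Matrix.specialUnitaryGroup (Fin N) ℂ)} {w : WorldP}
    (h : IsRecordOfRecord₁₁C F N D w)
    (hin : ∀ (θ : Stage11Params F N) (hP : θ.Provisos₁₁), θ.Admissible → D = datumOfRecord₁₁ F N θ hP → w.γ ≤ θ.γ →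
      ∃ s : ℝ, AtSlopeCont (oneLoopSplitOfRecord₁₁ F N θ) w.γ s) :
    ∃ γc : ℝ, 0 < γc ∧ BetaContH γc D.βfun := by
  obtain ⟨θ, hP, hθ, hD, -, ⟨hγ0, hγle⟩, -, -⟩ := h
  obtain ⟨s, hs⟩ := hin θ hP hθ hD hγle
  subst hD
  exact n26_datumOfRecord₁₁_of_atSlopeCont F N θ hP hγ0 hs

variable {F N} in
/-- **`N26_B4lit` AT `Rec := IsRecordOfRecord₁₁C`, RESIDUE CURRENCY — the ∀-form of record**: the rows-(D4) ∧ B4 residue at the record's split on the world's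
window, asked of every presentation of every Stage-11 record, gives the route supply's literal.  NOT-A-DISCHARGE (INHABITED-AT-₁₁C guard, K0 `Record11Inhabited`);
instance 0∕1. [cite: Balaban1987RG1, (1.20)-(1.22) p.264; Balaban1988RG2Cluster, Lemma 3 (2.38) p.20] -/
theorem n26_B4lit_rec11C_of_atSlopeCont
    (hin : ∀ (F : T4Family) (D : FiniteEpsData F (Matrix.specialUnitaryGroup (Fin N) ℂ)) (w : WorldP)
      (θ : Stage11Params F N) (hP : θ.Provisos₁₁), θ.Admissible → D = datumOfRecord₁₁ F N θ hP → w.γ ≤ θ.γ →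
      ∃ s : ℝ, AtSlopeCont (oneLoopSplitOfRecord₁₁ F N θ) w.γ s) :
    YMDAG.UVSplit.N26_B4lit (fun F D w => IsRecordOfRecord₁₁C F N D w) :=
  fun F D w h => n26_of_isRecordOfRecord₁₁C_of_atSlopeCont F N h (hin F D w)

end Route

/-! ## §5 «N26 closes WITH N25» in the two named predicates at the record's own split -/

section WithN25

/-- **N25's END ∧ N26 AT THE STAGE-11 DATUM, IN THE TWO NAMED β-SIDE PREDICATES AT THE RECORD'S OWN SPLIT**: row (D1)'s residue `Gaps.D1Residue.Residue Lc Js Nc μ ν`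
with its identification PINNED ON THE ONE-LOOP NUMBER OF RECORD (`hβ : beta0OfRecord₁₁ θ j = Σ_z T̄_j(z) z_μ z_ν` — by §0 the pin of EVERY split), and the rows-(D4) ∧
B4 residue `AtSlopeCont (oneLoopSplitOfRecord₁₁ F N θ) γ₀ (stepBal Nc Lc)` on a box `0 < γ₀` ⟹ `EndpointExistence D.C.toB12 ∧ ∃ γc > 0, BetaContH γc D.βfun` — the
drift (D1), the constant (D4), (UP) and (C) all DERIVED (`Gaps.BetaContFromD4Chain.endpointExistence_of_residue_atSlopeCont` at def-B's
`forwardGenerated_datumOfRecord₁₁`).  Instance 0∕1 on both predicates; N25 ∕ N26 NOT discharged.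
[cite: Balaban1987RG1, Thm 2 p.259 (first sentence), (1.20)-(1.22) p.264 and (2.12)-(2.14) p.268; Balaban1988RG2Cluster, Lemma 3 (2.38) p.20] -/
theorem endpoint_and_n26_datumOfRecord₁₁_of_residue_atSlopeCont (θ : Stage11Params F N) (hP : θ.Provisos₁₁) {Lc : ℕ} [NeZero Lc]
    (Js : ℕ → JetData 3 Lc) {Nc : ℝ} {μ ν : Fin 4} (hβ : ∀ j, beta0OfRecord₁₁ F N θ j = B12Beta.secondMoment (TbalOf Lc Js j) μ ν)
    (h1 : D1Residue.Residue Lc Js Nc μ ν) {γ₀ : ℝ} (hγ₀ : 0 < γ₀)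
    (hres : AtSlopeCont (oneLoopSplitOfRecord₁₁ F N θ) γ₀ (B12Normalization.stepBal Nc Lc)) :
    EndpointExistence (datumOfRecord₁₁ F N θ hP).C.toB12 ∧ ∃ γc : ℝ, 0 < γc ∧ BetaContH γc (datumOfRecord₁₁ F N θ hP).βfun :=
  ⟨endpointExistence_of_residue_atSlopeCont (forwardGenerated_datumOfRecord₁₁ F N θ hP) (oneLoopSplitOfRecord₁₁ F N θ) Js
      (fun j => hβ j) h1 hγ₀ hres,
    γ₀, hγ₀, betaContH_of_atSlopeCont hres⟩

/-- **N25's END ∧ N26 AT A STAGE-11 RECORD `(D, w)`, predicate form, residue currency**: the package `(D1)-residue + pin on beta0OfRecord₁₁ θ + AtSlopeCont at the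
record's split on the world's window at the one-loop slope stepBal Nc Lc` asked of EVERY admissible θ with provisos realising `D`.  Instance 0∕1; N25 ∕ N26 NOT
discharged. [cite: Balaban1987RG1, Thm 2 p.259 (first sentence) and (1.20)-(1.22) p.264; Balaban1988RG2Cluster, Lemma 3 (2.38) p.20] -/
theorem endpoint_and_n26_of_isRecordOfRecord₁₁C_of_residue_atSlopeCont {D : FiniteEpsData F (Matrix.specialUnitaryGroup (Fin N) ℂ)} {w : WorldP}
    (h : IsRecordOfRecord₁₁C F N D w)
    (hin : ∀ (θ : Stage11Params F N) (hP : θ.Provisos₁₁), θ.Admissible → D = datumOfRecord₁₁ F N θ hP → w.γ ≤ θ.γ →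
      ∃ (Lc : ℕ) (_ : NeZero Lc) (Js : ℕ → JetData 3 Lc) (Nc : ℝ) (μ ν : Fin 4),
        (∀ j, beta0OfRecord₁₁ F N θ j = B12Beta.secondMoment (TbalOf Lc Js j) μ ν) ∧ D1Residue.Residue Lc Js Nc μ ν ∧
        AtSlopeCont (oneLoopSplitOfRecord₁₁ F N θ) w.γ (B12Normalization.stepBal Nc Lc)) :
    EndpointExistence D.C.toB12 ∧ ∃ γc : ℝ, 0 < γc ∧ BetaContH γc D.βfun := by
  obtain ⟨θ, hP, hθ, hD, -, ⟨hγ0, hγle⟩, -, -⟩ := h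
  obtain ⟨Lc, _, Js, Nc, μ, ν, hβ, h1, hres⟩ := hin θ hP hθ hD hγle
  subst hD
  exact endpoint_and_n26_datumOfRecord₁₁_of_residue_atSlopeCont F N θ hP Js hβ h1 hγ0 hres

variable {F N} in
/-- **«N26 CLOSES WITH N25» AT `Rec := IsRecordOfRecord₁₁C`, RESIDUE CURRENCY**: the route literals `YMDAG.UVSplit.S_N25 Rec ∧ YMDAG.UVSplit.N26_B4lit Rec` from ONE
residue package per presentation — the β-side shape route crux K2 `EndpointGivenBR11` quantifies over (at `F 2`, with (B) and the window as further, here unused,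
hypotheses), now in the two named predicates of `Gaps.BetaContFromD4Chain` §3 at the record's own split.  ∀-forms, NOT-A-DISCHARGE (INHABITED-AT-₁₁C guard);
N25 ∕ N26 NOT discharged. [cite: Balaban1987RG1, Thm 2 p.259 (first sentence) and (1.20)-(1.22) p.264; Balaban1988RG2Cluster, Lemma 3 (2.38) p.20] -/
theorem s_N25_and_n26_B4lit_rec11C_of_residue_atSlopeCont
    (hin : ∀ (F : T4Family) (D : FiniteEpsData F (Matrix.specialUnitaryGroup (Fin N) ℂ)) (w : WorldP)
      (θ : Stage11Params F N) (hP : θ.Provisos₁₁), θ.Admissible → D = datumOfRecord₁₁ F N θ hP → w.γ ≤ θ.γ →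
      ∃ (Lc : ℕ) (_ : NeZero Lc) (Js : ℕ → JetData 3 Lc) (Nc : ℝ) (μ ν : Fin 4),
        (∀ j, beta0OfRecord₁₁ F N θ j = B12Beta.secondMoment (TbalOf Lc Js j) μ ν) ∧ D1Residue.Residue Lc Js Nc μ ν ∧
        AtSlopeCont (oneLoopSplitOfRecord₁₁ F N θ) w.γ (B12Normalization.stepBal Nc Lc)) :
    YMDAG.UVSplit.S_N25 (fun F D w => IsRecordOfRecord₁₁C F N D w) ∧
      YMDAG.UVSplit.N26_B4lit (fun F D w => IsRecordOfRecord₁₁C F N D w) :=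
  ⟨fun F D w h => (endpoint_and_n26_of_isRecordOfRecord₁₁C_of_residue_atSlopeCont F N h (hin F D w)).1,
    fun F D w h => (endpoint_and_n26_of_isRecordOfRecord₁₁C_of_residue_atSlopeCont F N h (hin F D w)).2⟩

end WithN25

end Summit.QuantumFields.YangMills.Theorems.BalabanUVNodesN26AtBetaOfRecord11

end
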